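import Literature.Geometry.Riemannian.PinchingFamily
import Literature.Geometry.Riemannian.PinchingEstimatesInitialFit
import HarnessLib

/-!
# Assembly: Chen–Zhu's Lemma 2.1 from the maximum principle and Hamilton's ODE estimates
(topic `Geometry/Riemannian`)

Top layer of the decomposition of the named fact
`Literature.Geometry.Riemannian.hamilton_chenZhu_pinching` (`PinchingEstimates.lean`; Chen–Zhu
2006, Lemma 2.1 = Hamilton 1997, Thm. B1.1 + Thm. B2.3). PROVED here:
`hamilton_chenZhu_pinching_of_ode` — the pinching fact follows from

1. the maximum principle for the curvature ODE (the named fact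
   `hamilton_maximumPrinciple_curvatureODE` of `HamiltonCurvatureODE.lean`; Hamilton 1986,
   Thm. 4.3, Chow–Lu 2004, Thm. 3),
2. the ODE parts of Hamilton's eight invariance theorems (Hamilton 1997, Thms. 1.2, 1.3, 1.4, 1.6,
   1.7, 1.9, 2.1 with Lemma 2.2, 2.3; taken as explicit HYPOTHESES `h12 … h23`, each of the form
   `HamiltonODE.IsInvariantRel field K Z` over the sets of `PinchingEstimatesODE.lean`, the
   constraint family `K` listing the previous estimates the printed proof uses together with the
   phase-space constraint `A, C` symmetric — and `tr A = tr C` where the Bianchi identity is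
   used; they are not yet proved in the tree), and
3. two compactness statements on the initial metric (hypotheses `hbd`: the curvature of a smooth
   Riemannian metric on a closed 4-manifold is bounded, blocks-wise in orthonormal frames, for
   all Levi-Civita connections of `g` at once — they have the same curvature,
   `IsLeviCivita.curvature_eq_riemann`; and `hpic`: PIC on a closed manifold is uniform,
   `a₁ + a₂, c₁ + c₂ ≥ m > 0` — Hamilton 1997, p. 8, with Lemma A2.1, proved in the tree as
   `hamilton_positiveIsotropicCurvature_iff_blocks_holds`),

exactly along Hamilton's proof of Thm. 1.1 (1997, pp. 7–21): the complete system of pinching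
inequalities `HamiltonODE.pinchingFamily` (`PinchingFamily.lean`) is closed, convex,
reflection-symmetric with closed space-time track, forward invariant under Hamilton's ODE
(`HamiltonODE.isInvariant_pinchingFamily`: chaining the eight hypotheses through the proved
Cors. 1.5, 1.8 of `PinchingEstimatesAlgebra.lean` and the proved invariance of the linear
constraints, `PinchingEstimatesConstraints.lean`), and contains the blocks of the initial metric
for constants chosen from the curvature bound `K₀` and the uniform PIC constant `m`
(`PinchingEstimatesInitialFit.lean`); the maximum principle propagates it, and Cors. 1.5, 1.8
with `Q ≥ 2` turn membership into Chen–Zhu's (2.1)–(2.3). What remains open for the discharge of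
`hamilton_chenZhu_pinching` is thus exactly: the named fact 1 and the ten hypotheses 2–3.

## References

* R. S. Hamilton, *Four-manifolds with positive isotropic curvature*, Comm. Anal. Geom. 5 (1997)
  1–92, §2, Thms. 1.2–2.3 and the proof of Thm. 1.1 (pp. 7–21). [Hamilton1997]
* B.-L. Chen, X.-P. Zhu, J. Differential Geom. 74 (2006), §2, Lemma 2.1. [ChenZhu2006]
* R. S. Hamilton, J. Differential Geom. 24 (1986), Thm. 4.3, §6. [Hamilton1986]
* B. Chow, P. Lu, Pacific J. Math. 214 (2004), Thm. 3. [ChowLu2004]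
-/

noncomputable section

open Set Real
open scoped Manifold ContDiff Topology Matrix

namespace Literature.Geometry.Riemannian

open Lorentzian Lorentzian.PseudoRiemannianMetric HamiltonODE

namespace HamiltonODE

variable {m Λ Φ ρ₁ ρ Ψ K L P Q : ℝ}

/-- **The family is forward invariant under Hamilton's ODE**, by chaining the ODE parts of
Hamilton 1997, Thms. 1.2, 1.3, 1.4, 1.6, 1.7, 1.9, 2.1, 2.3 — taken as hypotheses `s12 … s23`,
instantiated at the family's constants (`Ξ = Φ + 1`, `Ω = Ξ(Ψ + 1)`, `H = L/2`) — through the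
proved invariance of `{A, C symmetric}` and `{tr A = tr C}` and the proved Cors. 1.5, 1.8, for
constants with `m, Λ > 0`, `Φ ≥ Λ + 1`, `0 ≤ ρ₁ < ρ`.
[cite: Hamilton1997, §2, proof of Thm. 1.1 (pp. 7–20)] -/
theorem isInvariant_pinchingFamily (hm : 0 < m) (hΛ : 0 < Λ) (hΦ : Λ + 1 ≤ Φ) (hρ₁ : 0 ≤ ρ₁)
    (hρ : ρ₁ < ρ)
    (s12 : IsInvariantRel field (fun _ ↦ {p | p.1.IsSymm ∧ p.2.2.IsSymm})
        (fun _ ↦ {p | p.1.TwoSmallestEigenvaluesSumGE m}) ∧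
      IsInvariantRel field (fun _ ↦ {p | p.1.IsSymm ∧ p.2.2.IsSymm})
        (fun _ ↦ {p | p.2.2.TwoSmallestEigenvaluesSumGE m}))
    (s13 : IsInvariantRel field
      (fun _ ↦ {p | (p.1.IsSymm ∧ p.2.2.IsSymm) ∧ p.1.TwoSmallestEigenvaluesSumGE m ∧
        p.2.2.TwoSmallestEigenvaluesSumGE m})
      (fun _ ↦ {p | SingularValuesSumSqLE p Λ}))
    (s14 : IsInvariantRel field
      (fun _ ↦ {p | (p.1.IsSymm ∧ p.2.2.IsSymm) ∧ p.1.TwoSmallestEigenvaluesSumGE m ∧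
        p.2.2.TwoSmallestEigenvaluesSumGE m ∧ SingularValuesSumSqLE p Λ ∧
        p.1.trace = p.2.2.trace})
      (fun _ ↦ {p | p.1.TwoLargestEigenvaluesSumLE Φ ∧ p.2.2.TwoLargestEigenvaluesSumLE Φ}))
    (s16 : IsInvariantRel field
        (fun _ ↦ {p | (p.1.IsSymm ∧ p.2.2.IsSymm) ∧ p.1.TwoSmallestEigenvaluesSumGE m})
        (fun _ ↦ {p | p.1.SmallestEigenvalueAddNonneg ρ₁}) ∧
      IsInvariantRel field
        (fun _ ↦ {p | (p.1.IsSymm ∧ p.2.2.IsSymm) ∧ p.2.2.TwoSmallestEigenvaluesSumGE m})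
        (fun _ ↦ {p | p.2.2.SmallestEigenvalueAddNonneg ρ₁}))
    (s17 : IsInvariantRel field
      (fun _ ↦ {p | (p.1.IsSymm ∧ p.2.2.IsSymm) ∧ p.1.TwoSmallestEigenvaluesSumGE m ∧
        p.2.2.TwoSmallestEigenvaluesSumGE m ∧ MaxLEPairSum p (Φ + 1) ∧
        p.1.SmallestEigenvalueAddNonneg ρ ∧ p.2.2.SmallestEigenvalueAddNonneg ρ})
      (fun _ ↦ {p | p.1.LargestLESmallestAdd Ψ ρ ∧ p.2.2.LargestLESmallestAdd Ψ ρ}))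
    (s19 : IsInvariantRel field
      (fun _ ↦ {p | (p.1.IsSymm ∧ p.2.2.IsSymm) ∧ p.1.TwoSmallestEigenvaluesSumGE m ∧
        p.2.2.TwoSmallestEigenvaluesSumGE m ∧
        Matrix.PinchedBy p.1 p.2.1 p.2.2 ρ ((Φ + 1) * (Ψ + 1))})
      (fun t ↦ {p | SingularValueLEExp p (L / 2) P ρ t}))
    (s21 : IsInvariantRel field
      (fun _ ↦ {p | (p.1.IsSymm ∧ p.2.2.IsSymm) ∧ p.1.TwoSmallestEigenvaluesSumGE m ∧
        p.2.2.TwoSmallestEigenvaluesSumGE m ∧ SingularValuesSumSqLE p Λ ∧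
        MaxLEPairSum p (Φ + 1) ∧ p.1.trace = p.2.2.trace})
      (fun _ ↦ {p | ImprovedPinching p K}))
    (s23 : IsInvariantRel field
      (fun t ↦ {p | (p.1.IsSymm ∧ p.2.2.IsSymm) ∧ p.1.TwoSmallestEigenvaluesSumGE m ∧
        p.2.2.TwoSmallestEigenvaluesSumGE m ∧ SingularValuesSumSqLE p Λ ∧
        MaxLEPairSum p (Φ + 1) ∧ p.1.trace = p.2.2.trace ∧
        Matrix.PinchedBy p.1 p.2.1 p.2.2 ρ ((Φ + 1) * (Ψ + 1)) ∧ ImprovedPinching p K ∧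
        SingularValueLEExp p (L / 2) P ρ t})
      (fun t ↦ {p | ImprovedPinchingQ p ρ L P Q t})) :
    IsInvariant field (pinchingFamily m Λ Φ ρ₁ ρ Ψ K L P Q) := by
  have hΞ : 0 < Φ + 1 := by linarith
  -- symmetry, Thm. 1.2 (both blocks), Thm. 1.3, Bianchi, Thm. 1.4
  have s0 := (isInvariant_isSymm.inter_rel_self s12.1).inter_rel
    (K := fun _ ↦ {p : Blocks | p.1.IsSymm ∧ p.2.2.IsSymm}) (fun _ _ p hp ↦ hp.1) s12.2
  have s2 := s0.inter_rel (K := fun _ ↦ {p | (p.1.IsSymm ∧ p.2.2.IsSymm) ∧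
      p.1.TwoSmallestEigenvaluesSumGE m ∧ p.2.2.TwoSmallestEigenvaluesSumGE m})
    (fun _ _ p hp ↦ ⟨hp.1.1, hp.1.2, hp.2⟩) s13
  have s3 := s2.inter_rel (fun _ _ ↦ subset_univ _) isInvariant_trace_eq
  have s4 := s3.inter_rel (K := fun _ ↦ {p | (p.1.IsSymm ∧ p.2.2.IsSymm) ∧
      p.1.TwoSmallestEigenvaluesSumGE m ∧ p.2.2.TwoSmallestEigenvaluesSumGE m ∧
      SingularValuesSumSqLE p Λ ∧ p.1.trace = p.2.2.trace})
    (fun _ _ p hp ↦ ⟨hp.1.1.1.1, hp.1.1.1.2, hp.1.1.2, hp.1.2, hp.2⟩) s14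
  -- Thm. 1.6 (both blocks)
  have s5 := s4.inter_rel (K := fun _ ↦ {p | (p.1.IsSymm ∧ p.2.2.IsSymm) ∧
      p.1.TwoSmallestEigenvaluesSumGE m}) (fun _ _ p hp ↦ ⟨hp.1.1.1.1.1, hp.1.1.1.1.2⟩) s16.1
  have s6 := s5.inter_rel (K := fun _ ↦ {p | (p.1.IsSymm ∧ p.2.2.IsSymm) ∧
      p.2.2.TwoSmallestEigenvaluesSumGE m}) (fun _ _ p hp ↦ ⟨hp.1.1.1.1.1.1, hp.1.1.1.1.2⟩) s16.2
  -- Thm. 1.7, through Cor. 1.5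
  have s7 := s6.inter_rel (fun _ _ p hp ↦ ?_) s17
  swap
  · obtain ⟨⟨⟨⟨⟨⟨⟨h0, h1⟩, h2⟩, h3⟩, h4⟩, h5⟩, h6⟩, h7⟩ := hp
    exact ⟨h0, h1, h2, maxLEPairSum_of_estimates hm hΛ hΦ h1 h2 h3 h5.1 h5.2 h4,
      fun w hw ↦ (h6 w hw).trans (by linarith), fun w hw ↦ (h7 w hw).trans (by linarith)⟩
  -- Thm. 1.9 with `H = L/2`, through Cor. 1.8
  have s8 := s7.inter_rel (fun _ _ p hp ↦ ?_) s19
  swap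
  · obtain ⟨⟨⟨⟨⟨⟨⟨⟨h0, h1⟩, h2⟩, h3⟩, h4⟩, h5⟩, h6⟩, h7⟩, h8⟩ := hp
    have hMax := maxLEPairSum_of_estimates hm hΛ hΦ h1 h2 h3 h5.1 h5.2 h4
    exact ⟨h0, h1, h2, pinchedBy_of_estimates hΞ.le (by linarith) hMax h8.1 h8.2 fun w hw ↦
      ⟨by linarith [h6 w hw], by linarith [h7 w hw]⟩⟩
  -- Thm. 2.1, Thm. 2.3
  have s9 := s8.inter_rel (fun _ _ p hp ↦ ?_) s21
  swap
  · obtain ⟨⟨⟨⟨⟨⟨⟨⟨⟨h0, h1⟩, h2⟩, h3⟩, h4⟩, h5⟩, -⟩, -⟩, -⟩, -⟩ := hp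
    exact ⟨h0, h1, h2, h3, maxLEPairSum_of_estimates hm hΛ hΦ h1 h2 h3 h5.1 h5.2 h4, h4⟩
  have s10 := s9.inter_rel (fun t _ p hp ↦ ?_) s23
  swap
  · obtain ⟨⟨⟨⟨⟨⟨⟨⟨⟨⟨h0, h1⟩, h2⟩, h3⟩, h4⟩, h5⟩, h6⟩, h7⟩, h8⟩, h9⟩, h10⟩ := hp
    have hMax := maxLEPairSum_of_estimates hm hΛ hΦ h1 h2 h3 h5.1 h5.2 h4
    exact ⟨h0, h1, h2, h3, hMax, h4, pinchedBy_of_estimates hΞ.le (by linarith) hMax h8.1 h8.2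
      fun w hw ↦ ⟨by linarith [h6 w hw], by linarith [h7 w hw]⟩, h10, h9⟩
  exact s10

end HamiltonODE

/-! ### The assembly -/

universe u

/-- **Chen–Zhu 2006, Lemma 2.1 (= Hamilton 1997, Thm. B1.1 + Thm. B2.3) from the maximum
principle for the curvature ODE, the ODE parts of Hamilton's invariance theorems and the
compactness of the initial data.** Hypotheses: the named fact
`hamilton_maximumPrinciple_curvatureODE` (Hamilton 1986, Thm. 4.3; Chow–Lu 2004, Thm. 3); the
ODE parts of Hamilton 1997, Thm. 1.2 (`h12`: `{a₁ + a₂ ≥ m}`, `{c₁ + c₂ ≥ m}` invariant, `m > 0`),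
Thm. 1.3 (`h13`), Thm. 1.4 (`h14`, `Φ ≥ Λ + 1`, using `tr A = tr C`), Thm. 1.6 (`h16`, any `ρ`),
Thm. 1.7 (`h17`, `Ψ ≥ 4Ξ² + 1`), Thm. 1.9 (`h19`, `P ≥ 4Ωρ`, any `H > 0`), Thm. 2.1 with
Lemma 2.2 (`h21`: for `K ≥ 0` beyond a threshold depending on `m, Λ, Ξ`), Thm. 2.3 (`h23`: for
some `Q ≥ 2` and positive `L, P` beyond thresholds depending on `m, Λ, Ξ, ρ, Ω, K`), each
relative to the previous estimates on the phase space `A, C` symmetric; and the two compactness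
statements on a
closed 4-manifold (`hbd`: blocks-wise curvature bound; `hpic`: uniform PIC, Hamilton 1997, p. 8
with Lemma A2.1). Conclusion: the named fact `hamilton_chenZhu_pinching`. Proof as in Hamilton
1997, pp. 7–21: choose the constants from the initial curvature bound `K₀` and the uniform PIC
constant `m` (`Λ = 4K₀²/m² + 1`, `Φ = Λ + 1 + 2K₀/m`, `Ξ = Φ + 1`, `ρ = K₀ + 1`,
`Ψ = 4Ξ² + 1 + K₀`, `Ω = Ξ(Ψ + 1)`, then `K`, `Q`, `L`, `P` from Thms. 2.1, 2.3, 1.9 and the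
initial fit), propagate `HamiltonODE.pinchingFamily` by the maximum principle, and read off
(2.1)–(2.3) with the constants `(ρ, max{Ω, L}, P)`.
[cite: ChenZhu2006, §2, Lemma 2.1] [cite: Hamilton1997, §2, Thms. 1.2–2.3 and Thm. 1.1 (proof, pp. 7–21)] -/
theorem hamilton_chenZhu_pinching_of_ode (hMP : hamilton_maximumPrinciple_curvatureODE.{u})
    (h12 : ∀ m : ℝ, 0 < m →
      IsInvariantRel field (fun _ ↦ {p | p.1.IsSymm ∧ p.2.2.IsSymm})
          (fun _ ↦ {p | p.1.TwoSmallestEigenvaluesSumGE m}) ∧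
        IsInvariantRel field (fun _ ↦ {p | p.1.IsSymm ∧ p.2.2.IsSymm})
          (fun _ ↦ {p | p.2.2.TwoSmallestEigenvaluesSumGE m}))
    (h13 : ∀ m Λ : ℝ, 0 < m → 0 < Λ →
      IsInvariantRel field
        (fun _ ↦ {p | (p.1.IsSymm ∧ p.2.2.IsSymm) ∧ p.1.TwoSmallestEigenvaluesSumGE m ∧
          p.2.2.TwoSmallestEigenvaluesSumGE m})
        (fun _ ↦ {p | SingularValuesSumSqLE p Λ}))
    (h14 : ∀ m Λ Φ : ℝ, 0 < m → 0 < Λ → Λ + 1 ≤ Φ →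
      IsInvariantRel field
        (fun _ ↦ {p | (p.1.IsSymm ∧ p.2.2.IsSymm) ∧ p.1.TwoSmallestEigenvaluesSumGE m ∧
          p.2.2.TwoSmallestEigenvaluesSumGE m ∧ SingularValuesSumSqLE p Λ ∧
          p.1.trace = p.2.2.trace})
        (fun _ ↦ {p | p.1.TwoLargestEigenvaluesSumLE Φ ∧ p.2.2.TwoLargestEigenvaluesSumLE Φ}))
    (h16 : ∀ m ρ : ℝ, 0 < m →
      IsInvariantRel field
          (fun _ ↦ {p | (p.1.IsSymm ∧ p.2.2.IsSymm) ∧ p.1.TwoSmallestEigenvaluesSumGE m})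
          (fun _ ↦ {p | p.1.SmallestEigenvalueAddNonneg ρ}) ∧
        IsInvariantRel field
          (fun _ ↦ {p | (p.1.IsSymm ∧ p.2.2.IsSymm) ∧ p.2.2.TwoSmallestEigenvaluesSumGE m})
          (fun _ ↦ {p | p.2.2.SmallestEigenvalueAddNonneg ρ}))
    (h17 : ∀ m Ξ ρ Ψ : ℝ, 0 < m → 0 < Ξ → 4 * Ξ ^ 2 + 1 ≤ Ψ →
      IsInvariantRel field
        (fun _ ↦ {p | (p.1.IsSymm ∧ p.2.2.IsSymm) ∧ p.1.TwoSmallestEigenvaluesSumGE m ∧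
          p.2.2.TwoSmallestEigenvaluesSumGE m ∧ MaxLEPairSum p Ξ ∧
          p.1.SmallestEigenvalueAddNonneg ρ ∧ p.2.2.SmallestEigenvalueAddNonneg ρ})
        (fun _ ↦ {p | p.1.LargestLESmallestAdd Ψ ρ ∧ p.2.2.LargestLESmallestAdd Ψ ρ}))
    (h19 : ∀ m ρ Ω P H : ℝ, 0 < m → 0 < ρ → 0 < Ω → 4 * Ω * ρ ≤ P → 0 < H →
      IsInvariantRel field
        (fun _ ↦ {p | (p.1.IsSymm ∧ p.2.2.IsSymm) ∧ p.1.TwoSmallestEigenvaluesSumGE m ∧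
          p.2.2.TwoSmallestEigenvaluesSumGE m ∧ Matrix.PinchedBy p.1 p.2.1 p.2.2 ρ Ω})
        (fun t ↦ {p | SingularValueLEExp p H P ρ t}))
    (h21 : ∀ m Λ Ξ : ℝ, 0 < m → 0 < Λ → 0 < Ξ → ∃ K₀ : ℝ, ∀ K : ℝ, K₀ ≤ K → 0 ≤ K →
      IsInvariantRel field
        (fun _ ↦ {p | (p.1.IsSymm ∧ p.2.2.IsSymm) ∧ p.1.TwoSmallestEigenvaluesSumGE m ∧
          p.2.2.TwoSmallestEigenvaluesSumGE m ∧ SingularValuesSumSqLE p Λ ∧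
          MaxLEPairSum p Ξ ∧ p.1.trace = p.2.2.trace})
        (fun _ ↦ {p | ImprovedPinching p K}))
    (h23 : ∀ m Λ Ξ ρ Ω K : ℝ, 0 < m → 0 < Λ → 0 < Ξ → 0 < ρ → 0 < Ω →
      ∃ Q : ℝ, 2 ≤ Q ∧ ∃ L₀ P₀ : ℝ, ∀ L P : ℝ, L₀ ≤ L → P₀ ≤ P → 0 < L → 0 < P →
        IsInvariantRel field
          (fun t ↦ {p | (p.1.IsSymm ∧ p.2.2.IsSymm) ∧ p.1.TwoSmallestEigenvaluesSumGE m ∧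
            p.2.2.TwoSmallestEigenvaluesSumGE m ∧ SingularValuesSumSqLE p Λ ∧
            MaxLEPairSum p Ξ ∧ p.1.trace = p.2.2.trace ∧
            Matrix.PinchedBy p.1 p.2.1 p.2.2 ρ Ω ∧ ImprovedPinching p K ∧
            SingularValueLEExp p (L / 2) P ρ t})
          (fun t ↦ {p | ImprovedPinchingQ p ρ L P Q t}))
    (hbd : ∀ (M : Type u) [TopologicalSpace M] [T2Space M] [SecondCountableTopology M]
      [CompactSpace M] [ChartedSpace (EuclideanSpace ℝ (Fin 4)) M] [IsManifold (𝓡 4) ∞ M]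
      (g : PseudoRiemannianMetric (𝓡 4) ∞ (EuclideanSpace ℝ (Fin 4))
        (TangentSpace (𝓡 4) : M → Type _)),
      g.IsRiemannian →
        ∃ K₀ : ℝ, 0 ≤ K₀ ∧
          ∀ (cov : CovariantDerivative (𝓡 4) (EuclideanSpace ℝ (Fin 4))
            (TangentSpace (𝓡 4) : M → Type _)), g.IsLeviCivita cov →
            ∀ (x : M) (e : Fin 4 → TangentSpace (𝓡 4) x), g.IsOrthonormalFrame x e →
              ∀ u v : Fin 3 → ℝ, u ⬝ᵥ u = 1 → v ⬝ᵥ v = 1 →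
                |u ⬝ᵥ (g.blockA cov x e *ᵥ v)| ≤ K₀ ∧ |u ⬝ᵥ (g.blockB cov x e *ᵥ v)| ≤ K₀ ∧
                  |u ⬝ᵥ (g.blockC cov x e *ᵥ v)| ≤ K₀)
    (hpic : ∀ (M : Type u) [TopologicalSpace M] [T2Space M] [SecondCountableTopology M]
      [CompactSpace M] [ChartedSpace (EuclideanSpace ℝ (Fin 4)) M] [IsManifold (𝓡 4) ∞ M]
      (g : PseudoRiemannianMetric (𝓡 4) ∞ (EuclideanSpace ℝ (Fin 4))
        (TangentSpace (𝓡 4) : M → Type _)),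
      g.IsRiemannian → g.HasPositiveIsotropicCurvature →
        ∃ m : ℝ, 0 < m ∧
          ∀ (cov : CovariantDerivative (𝓡 4) (EuclideanSpace ℝ (Fin 4))
            (TangentSpace (𝓡 4) : M → Type _)), g.IsLeviCivita cov →
            ∀ (x : M) (e : Fin 4 → TangentSpace (𝓡 4) x), g.IsOrthonormalFrame x e →
              (g.blockA cov x e).TwoSmallestEigenvaluesSumGE m ∧
                (g.blockC cov x e).TwoSmallestEigenvaluesSumGE m) :
    hamilton_chenZhu_pinching.{u} := by
  intro M _ _ _ _ _ _ g₀ hg₀ hPIC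
  obtain ⟨K₀, hK₀, hbd'⟩ := hbd M g₀ hg₀
  obtain ⟨m, hm, hpic'⟩ := hpic M g₀ hg₀ hPIC
  -- Hamilton's constants
  set Λ : ℝ := 4 * K₀ ^ 2 / m ^ 2 + 1 with hΛdef
  have hΛ : 0 < Λ := by positivity
  set Φ : ℝ := Λ + 1 + 2 * K₀ / m with hΦdef
  have h2K : 0 ≤ 2 * K₀ / m := by positivity
  have hΦ : Λ + 1 ≤ Φ := by rw [hΦdef]; linarith
  have hΞ : 0 < Φ + 1 := by linarith
  set ρ : ℝ := K₀ + 1 with hρdef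
  set Ψ : ℝ := 4 * (Φ + 1) ^ 2 + 1 + K₀ with hΨdef
  have hΨ0 : 0 ≤ Ψ := by positivity
  set Ω : ℝ := (Φ + 1) * (Ψ + 1) with hΩdef
  have hΩ : 0 < Ω := by positivity
  obtain ⟨K₁, hK₁⟩ := h21 m Λ (Φ + 1) hm hΛ hΞ
  set K : ℝ := max (max K₁ 0) (2 * K₀ * max (2 * K₀) 2 / m) with hKdef
  have hK0 : 0 ≤ K := (le_max_right _ _).trans (le_max_left _ _)
  obtain ⟨Q, hQ, L₀, P₀, h23'⟩ := h23 m Λ (Φ + 1) ρ Ω K hm hΛ hΞ (by positivity) hΩ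
  set L : ℝ := max (max L₀ (2 * K₀ + 1)) (K₀ * max (2 * K₀ + 1) Q) with hLdef
  have hL0 : 0 < L := lt_of_lt_of_le (by positivity) ((le_max_right _ _).trans (le_max_left _ _))
  set P : ℝ := max (max P₀ (4 * Ω * ρ)) 1 with hPdef
  have hP0 : 0 < P := lt_of_lt_of_le one_pos (le_max_right _ _)
  refine ⟨ρ, max Ω L, P, by positivity, lt_max_of_lt_left hΩ, hP0, ?_⟩
  intro T g cov hflow hRiem hg0 t ht x e he
  have hT : 0 < T := ht.1.trans_lt ht.2
  subst hg0
  have hn : (2 : ℕ∞ω) ≤ ∞ := WithTop.coe_le_coe.mpr le_top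
  -- the invariant family and its properties
  set Z := pinchingFamily m Λ Φ (K₀ + 1 / 2) ρ Ψ K L P Q with hZdef
  have hQ0 : 0 < Q := by linarith
  have hinv : IsInvariant field Z :=
    isInvariant_pinchingFamily hm hΛ hΦ (by positivity) (by rw [hρdef]; linarith)
      (h12 m hm) (h13 m Λ hm hΛ) (h14 m Λ Φ hm hΛ hΦ) (h16 m (K₀ + 1 / 2) hm)
      (h17 m (Φ + 1) ρ Ψ hm hΞ (by rw [hΨdef]; linarith))
      (h19 m ρ ((Φ + 1) * (Ψ + 1)) P (L / 2) hm (by positivity) hΩ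
        ((le_max_right _ _).trans (le_max_left _ _)) (by linarith))
      (hK₁ K ((le_max_left _ _).trans (le_max_left _ _)) hK0)
      (h23' L P ((le_max_left _ _).trans (le_max_left _ _))
        ((le_max_left _ _).trans (le_max_left _ _)) hL0 hP0)
  have hmem := hMP M T g cov hflow hRiem Z (isClosed_pinchingFamily hQ0)
    (convex_pinchingFamily hm.le hΛ.le (by rw [hρdef]; linarith) hK0 hL0.le hQ)
    (isClosed_pinchingFamily_track hQ0) (fun _ _ hp ↦ reflectB_mem_pinchingFamily hp) hinv
    ?init t ht x e he
  case init =>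
    -- the blocks of the initial metric lie in `Z 0`
    intro x e he
    have hLC := hflow.isLeviCivita 0 ⟨le_rfl, hT⟩
    have hb := hbd' (cov 0) hLC x e he
    obtain ⟨hA, hC⟩ := hpic' (cov 0) hLC x e he
    set p : Blocks := ((g 0).blockA (cov 0) x e, (g 0).blockB (cov 0) x e,
      (g 0).blockC (cov 0) x e) with hpdef
    have hb' : ∀ u v : Fin 3 → ℝ, u ⬝ᵥ u = 1 → v ⬝ᵥ v = 1 → |u ⬝ᵥ (p.1 *ᵥ v)| ≤ K₀ ∧
        |u ⬝ᵥ (p.2.1 *ᵥ v)| ≤ K₀ ∧ |u ⬝ᵥ (p.2.2 *ᵥ v)| ≤ K₀ := hb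
    have hA' : p.1.TwoSmallestEigenvaluesSumGE m := hA
    have hC' : p.2.2.TwoSmallestEigenvaluesSumGE m := hC
    have hΛm : 4 * K₀ ^ 2 ≤ Λ * m ^ 2 := by
      rw [hΛdef, add_mul, div_mul_cancel₀ _ (by positivity)]; nlinarith
    have hΦm : 2 * K₀ ≤ Φ * m := by
      rw [hΦdef, add_mul, div_mul_cancel₀ _ hm.ne']
      nlinarith [hΛ.le]
    have hKm : 2 * K₀ * max (2 * K₀) 2 ≤ K * m := by
      have : 2 * K₀ * max (2 * K₀) 2 / m * m ≤ K * m :=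
        mul_le_mul_of_nonneg_right (le_max_right _ _) hm.le
      rwa [div_mul_cancel₀ _ hm.ne'] at this
    have h17 := InitialFit.largestLESmallestAdd (Ψ := Ψ) (ρ := ρ) hb' le_rfl
      (by rw [hΨdef]; nlinarith)
    refine ⟨⟨⟨⟨⟨⟨⟨⟨⟨⟨⟨?_, hA'⟩, hC'⟩, ?_⟩, ?_⟩, ?_⟩, ?_⟩, ?_⟩, h17⟩, ?_⟩, ?_⟩, ?_⟩
    · exact ⟨blockA_isSymm hLC hn x e, blockC_isSymm hLC hn x e⟩
    · exact InitialFit.singularValuesSumSqLE hm hb' hA' hC' hΛm hΛ.le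
    · exact trace_blockA_eq_trace_blockC hLC hn x e
    · exact ⟨InitialFit.twoLargestA hK₀ hm hb' hA' hΦm, InitialFit.twoLargestC hK₀ hm hb' hC' hΦm⟩
    · exact (InitialFit.smallestAddNonneg hb' (by linarith)).1
    · exact (InitialFit.smallestAddNonneg hb' (by linarith)).2
    · exact InitialFit.singularValueLEExp hb' le_rfl
        (by rw [hLdef]; linarith [le_max_left (max L₀ (2 * K₀ + 1)) (K₀ * max (2 * K₀ + 1) Q),
          le_max_right L₀ (2 * K₀ + 1)])
    · exact InitialFit.improvedPinching hK₀ hm hb' hA' hC' hKm hK0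
    · exact InitialFit.improvedPinchingQ hK₀ hb' hQ0 (le_max_right _ _) hL0.le
  -- read off (2.1)–(2.3)
  obtain ⟨-, hpin⟩ := maxLE_and_pinchedBy_of_mem hm hΛ hΦ (by positivity)
    (by rw [hρdef]; linarith) hmem
  refine ⟨hpin.mono (le_max_left _ _), ?_⟩
  have h23mem : ImprovedPinchingQ _ ρ L P Q t := hmem.2
  exact (h23mem.improvedPinchingAt hL0.le hQ).mono (le_max_right _ _)

end Literature.Geometry.Riemannian

end
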